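import Summits.HodgeConjecture.HodgeConjecture.Theorems.Ring2WeilCoverageCMFieldCyclicPrimeRuleSqrtFive
import HarnessLib

/-!
# Ring 2 — Weil-family coverage, CM-field rows: COFACTOR FORMS `[ℓ·w] ≠ [1]` (`ℓ ∤ w`) of the non-split primes of a
  quadratic carrier — inert primes, split primes via the root character, and a prime inert in `F` but RAMIFIED in `E`
  (WEIL-FAMILY-COVERAGE «## b03», cell (xxi⁗), part 27)

research route conditional on HC_CM; not a corollary; Q11.4-sentence-2 already refuted in dim ≥ 3.

The INTEGER rows `W_{2k}.E.[n]` of the census tables (Deligne's carrier `R = S² + pS + q`, `F = ℚ(θ)`, `E = F(√θ)`,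
classes `[n] ∈ F^×/Nm_{E/F}(E^×)` labelled by `T(n) = {𝔭 : (n, θ)_𝔭 = -1}` [cite: Deligne1982HodgeCycles, §4 p. 30, (1),
Cor. 4.2]) are classified by part IX-M's `natCast_eq_split_iff_even` («`[n] = [1]` iff every non-split prime divides `n`
to an even power») as soon as each non-split prime `ℓ` (but one) obstructs WITH A COFACTOR: `[ℓ·w] ≠ [1]` for every
integer `w` prime to `ℓ`.  The local route gives these cofactor forms at once, because the bad place found for `ℓ` in
parts 21–26 has `ord_v(ℓ·w) = ord_v ℓ` odd:

* §68 (a) **inert**: `ℓ` odd, `p² - 4q` and `q` non-squares mod `ℓ` ⟹ `[ℓ·w] ≠ [(-1)^k]` (the place `(ℓ)`, part 21);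
  (b) **split**: `ℓ` odd, `ℓ ∤ q(p² - 4q)`, a root `r̄ ∈ 𝔽_ℓ` of `R̄` a non-square ⟹ `[ℓ·w] ≠ [(-1)^k]` (the degree-one place
  `(ℓ, θ - r)`, part 22), with its character form; (c) **inert in `F`, ramified in `E`** (`θ = π·t`, `π` a uniformiser at
  the non-dyadic place `v`, `t ∉ v`): for a `v`-unit `w` which is a square mod `v`, `(π·w, θ)_v = -1 ⟺ -t` is a non-square
  mod `v` (O'Meara 63:12: `(πa, πb)_v = 1 ⟺ -ab` square), so `[π·w] ≠ [(-1)^k]` (`k` even) — the prime `3` of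
  `ℚ(√-3(5+√5)/2)` (`θ = 3·θ_{ℚ(ζ₅)}`).
The sequel assembles the integer classifications of the three cyclic b03.29 tables.  No new definition, no named fact,
no sorry; nothing about the Hodge conjecture is asserted.
-/

noncomputable section

set_option linter.dupNamespace false

open Polynomial NumberField IsDedekindDomain

namespace Summit.HodgeConjecture.HodgeConjecture.Ring2.WeilCoverageCM

open Literature.AlgebraicGeometry.Deligne1982
open Literature.AlgebraicGeometry.HodgeTheory (splitDiscriminantClassCM)
open Literature.NumberTheory.QuadraticForms

variable {R : Polynomial ℤ} [Fact (Irreducible (cmPolyQ R))] [Fact (Irreducible (realPolyQ R))]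

/-! ### §68 Cofactor forms of the non-split primes -/

omit [Fact (Irreducible (cmPolyQ R))] in
/-- An integer prime to `ℓ` is a unit at every place over `ℓ`, hence `log v(w) = 0` there. [folklore] -/
theorem log_valuation_intCast_eq_zero_of_not_dvd (v : HeightOneSpectrum (𝓞 (realField R))) {ℓ : ℕ} (hℓ : ℓ.Prime)
    (hℓv : (ℓ : 𝓞 (realField R)) ∈ v.asIdeal) {w : ℤ} (hw : ¬ (ℓ : ℤ) ∣ w) :
    (w : 𝓞 (realField R)) ∉ v.asIdeal ∧ WithZero.log (v.valuation (realField R) (w : realField R)) = 0 := by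
  have hℓZ : Prime (ℓ : ℤ) := Nat.prime_iff_prime_int.1 hℓ
  have hwv : (w : 𝓞 (realField R)) ∉ v.asIdeal :=
    intCast_notMem_of_isCoprime v ((Prime.coprime_iff_not_dvd hℓZ).2 hw) (by push_cast; exact hℓv)
  refine ⟨hwv, ?_⟩
  have h := log_valuation_coe_eq_zero_of_notMem v hwv
  rwa [show ((w : 𝓞 (realField R)) : realField R) = (w : realField R) from
    map_intCast (algebraMap (𝓞 (realField R)) (realField R)) w] at h

/-- **(a) INERT primes with a cofactor.** `R = S² + pS + q`, `ℓ` an odd prime with `p² - 4q` AND `q` non-squares mod `ℓ`,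
`w ∈ ℤ` with `ℓ ∤ w`: **`[ℓ·w] ≠ [(-1)^k]` for every `k`** — the place `v = (ℓ)` has `θ` a unit non-square mod `v`
(part 21, Frobenius of `𝔽_{ℓ²}`) and `ord_v(ℓw) = 1`. [cite: Deligne1982HodgeCycles, §4 (1) and Cor. 4.2]
[cite: Omeara1963, §63B Example 63:12] -/
theorem mk_natCast_mul_ne_splitDiscriminantClassCM_of_not_isSquare_disc_const {p q : ℤ}
    (hR : R = X ^ 2 + C p * X + C q) {ℓ : ℕ} (hℓ : ℓ.Prime) (hℓ2 : ℓ ≠ 2)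
    (hdisc : ¬ IsSquare ((p ^ 2 - 4 * q : ℤ) : ZMod ℓ)) (hq : ¬ IsSquare ((q : ℤ) : ZMod ℓ))
    {w : ℤ} (hw : ¬ (ℓ : ℤ) ∣ w) (qℓ : (realField R)ˣ) (hqℓ : (qℓ : realField R) = (ℓ : realField R) * (w : realField R))
    (k : ℕ) : (QuotientGroup.mk qℓ : cmNormResidueGroup R) ≠ splitDiscriminantClassCM R k := by
  have hK := finrank_realField_quadratic hR
  obtain ⟨hRm, -⟩ := monic_and_natDegree_of_quadratic R hR
  obtain ⟨θₒ, hθ⟩ := exists_ringOfIntegers_coe_eq_root hRm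
  have hℓZ : Prime (ℓ : ℤ) := Nat.prime_iff_prime_int.1 hℓ
  obtain ⟨v, hℓv⟩ := exists_place_natCast_mem hK hℓ
  have hℓv' : ((ℓ : ℤ) : 𝓞 (realField R)) ∈ v.asIdeal := by push_cast; exact hℓv
  -- `v = (ℓ)`, `ord_v ℓ = 1`
  have hN := absNorm_eq_sq_of_not_isSquare_disc hR hθ hℓ hdisc v hℓv
  have hv : v.asIdeal = Ideal.span {(ℓ : 𝓞 (realField R))} :=
    (ideal_eq_of_le_of_absNorm_eq ((Ideal.span_singleton_le_iff_mem _).2 hℓv) (by rw [hN]; exact pow_ne_zero _ hℓ.ne_zero)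
      (by rw [absNorm_span_natCast, hK, hN])).symm
  have hord : WithZero.log (v.valuation (realField R) (ℓ : realField R)) = -1 := by
    rw [show (ℓ : realField R) = algebraMap (𝓞 (realField R)) (realField R) (ℓ : 𝓞 (realField R)) by
      rw [map_natCast], HeightOneSpectrum.valuation_of_algebraMap,
      HeightOneSpectrum.intValuation_singleton (v := v) (by exact_mod_cast hℓ.ne_zero) hv, WithZero.log_exp]
  have h2 : (2 : 𝓞 (realField R)) ∉ v.asIdeal := by
    have h2' : ¬ (ℓ : ℤ) ∣ 2 := fun h ↦ by
      have := Int.le_of_dvd (by norm_num) h; have := hℓ.two_le; omega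
    have := intCast_notMem_of_isCoprime v ((Prime.coprime_iff_not_dvd hℓZ).2 h2') hℓv'
    push_cast at this; exact this
  have hq0 : ¬ (ℓ : ℤ) ∣ q := fun h ↦ hq (by
    rw [(ZMod.intCast_zmod_eq_zero_iff_dvd q ℓ).2 h]; exact IsSquare.zero)
  have hθv : θₒ ∉ v.asIdeal := fun h ↦
    intCast_notMem_of_isCoprime v ((Prime.coprime_iff_not_dvd hℓZ).2 hq0) hℓv' (intCast_mem_of_root_mem hR hθ v h)
  have hns := not_isSquare_residue_root_of_not_isSquare_disc_const hR hθ hℓ hdisc hq v hℓv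
  obtain ⟨-, hw0⟩ := log_valuation_intCast_eq_zero_of_not_dvd v hℓ hℓv hw
  have hℓne : v.valuation (realField R) (ℓ : realField R) ≠ 0 :=
    (Valuation.ne_zero_iff _).2 (by exact_mod_cast hℓ.ne_zero)
  have hwz : w ≠ 0 := fun h ↦ hw (by rw [h]; exact dvd_zero _)
  have hwne : v.valuation (realField R) (w : realField R) ≠ 0 :=
    (Valuation.ne_zero_iff _).2 (by exact_mod_cast hwz)
  have hodd : Odd (WithZero.log (v.valuation (realField R) (qℓ : realField R))) := by
    rw [hqℓ, map_mul, WithZero.log_mul hℓne hwne, hord, hw0]; decide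
  exact mk_ne_splitDiscriminantClassCM_of_odd_log_valuation hθ v h2 hθv hns hodd k

/-- **(b) SPLIT primes with a cofactor.** `R = S² + pS + q`, `ℓ` an odd prime, `ℓ ∤ q`, `ℓ ∤ p² - 4q`, a root `r̄ ∈ 𝔽_ℓ` of
`S² + pS + q` which is a NON-square, `w ∈ ℤ` with `ℓ ∤ w`: **`[ℓ·w] ≠ [(-1)^k]` for every `k`** — the degree-one place
`𝔭 = (ℓ, θ - r)` of part 22 (`θ ≡ r` a unit non-square, `ord_𝔭 ℓ = 1`, `w` a `𝔭`-unit).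
[cite: Deligne1982HodgeCycles, §4 (1) and Cor. 4.2] [cite: Omeara1963, §63B Example 63:12] -/
theorem mk_natCast_mul_ne_splitDiscriminantClassCM_of_root_not_isSquare {p q : ℤ} (hR : R = X ^ 2 + C p * X + C q)
    {ℓ : ℕ} (hℓ : ℓ.Prime) (hℓ2 : ℓ ≠ 2) (hℓq : ¬ (ℓ : ℤ) ∣ q) (hdisc : ¬ (ℓ : ℤ) ∣ p ^ 2 - 4 * q)
    {r₀ : ZMod ℓ} (hr₀ : r₀ ^ 2 + (p : ZMod ℓ) * r₀ + (q : ZMod ℓ) = 0) (hns₀ : ¬ IsSquare r₀)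
    {w : ℤ} (hw : ¬ (ℓ : ℤ) ∣ w) (qℓ : (realField R)ˣ) (hqℓ : (qℓ : realField R) = (ℓ : realField R) * (w : realField R))
    (k : ℕ) : (QuotientGroup.mk qℓ : cmNormResidueGroup R) ≠ splitDiscriminantClassCM R k := by
  haveI := Fact.mk hℓ
  have hK := finrank_realField_quadratic hR
  obtain ⟨hRm, -⟩ := monic_and_natDegree_of_quadratic R hR
  obtain ⟨θₒ, hθ⟩ := exists_ringOfIntegers_coe_eq_root hRm
  have hrel := ringOfIntegers_root_rel_quadratic hR hθ
  have hℓZ : Prime (ℓ : ℤ) := Nat.prime_iff_prime_int.1 hℓ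
  obtain ⟨r₁, rfl⟩ := ZMod.intCast_surjective r₀
  have hR₁ : (ℓ : ℤ) ∣ r₁ ^ 2 + p * r₁ + q := by
    rw [← ZMod.intCast_zmod_eq_zero_iff_dvd]; push_cast; exact hr₀
  have hsd : (ℓ : ℤ) ∣ (2 * r₁ + p) * (2 * r₁ + p) - (p ^ 2 - 4 * q) := by
    have e : (2 * r₁ + p) * (2 * r₁ + p) - (p ^ 2 - 4 * q) = 4 * (r₁ ^ 2 + p * r₁ + q) := by ring
    rw [e]; exact Dvd.dvd.mul_left hR₁ 4
  obtain ⟨r, hrs, hRr, hR2⟩ := exists_root_mod_of_sq_sub_disc_dvd hℓ hℓ2 hdisc hsd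
  have hrr₁ : (r : ZMod ℓ) = (r₁ : ZMod ℓ) := by
    have h2 : (ℓ : ℤ) ∣ 2 * (r - r₁) := by
      have := hrs; rw [show 2 * r + p - (2 * r₁ + p) = 2 * (r - r₁) by ring] at this; exact this
    have h2' : ¬ (ℓ : ℤ) ∣ 2 := fun h ↦ by
      have := Int.le_of_dvd (by norm_num) h; have := hℓ.two_le; omega
    have h3 : (ℓ : ℤ) ∣ r - r₁ := (hℓZ.dvd_or_dvd h2).resolve_left h2'
    have := (ZMod.intCast_zmod_eq_zero_iff_dvd _ ℓ).2 h3
    push_cast at this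
    exact sub_eq_zero.1 this
  obtain ⟨m₁, hm₁⟩ := hRr
  have hm₁ℓ : ¬ (ℓ : ℤ) ∣ m₁ := fun h ↦ hR2 (by rw [hm₁, sq]; exact mul_dvd_mul_left _ h)
  have h2rp : ¬ (ℓ : ℤ) ∣ 2 * r + p := fun h ↦ hdisc (by
    have e : p ^ 2 - 4 * q = (2 * r + p) * (2 * r + p) - 4 * (r ^ 2 + p * r + q) := by ring
    rw [e, hm₁]
    exact dvd_sub (dvd_mul_of_dvd_left h _) (Dvd.dvd.mul_left (dvd_mul_right _ _) _))
  set x : 𝓞 (realField R) := θₒ - r with hx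
  set x' : 𝓞 (realField R) := -θₒ - r - p with hx'
  have hxx' : x * x' = ℓ * m₁ := by
    have e : ((ℓ : ℤ) : 𝓞 (realField R)) * (m₁ : 𝓞 (realField R)) = ((r ^ 2 + p * r + q : ℤ) : 𝓞 (realField R)) := by
      rw [hm₁]; push_cast; ring
    rw [hx, hx', show (ℓ : 𝓞 (realField R)) = ((ℓ : ℤ) : 𝓞 (realField R)) by push_cast; rfl, e]
    push_cast
    linear_combination (-1 : 𝓞 (realField R)) * hrel
  have hNx : (Algebra.norm ℤ x).natAbs = ℓ * m₁.natAbs := by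
    rw [hx, norm_int_root_sub_intCast hR hθ r, hm₁, Int.natAbs_mul, Int.natAbs_natCast]
  have hNx' : ¬ ((ℓ : ℤ) ^ 2) ∣ Algebra.norm ℤ x' := by
    rw [hx', norm_int_neg_root_sub_intCast_sub hR hθ r]; exact hR2
  have hm₁' : ¬ ℓ ∣ m₁.natAbs := fun h ↦ hm₁ℓ (Int.natCast_dvd.2 h)
  obtain ⟨v, hv, hNv, hℓv, hxv⟩ := exists_place_absNorm_eq_of_norm hK hℓ hxx' hNx' hNx hm₁'
  have hℓv' : ((ℓ : ℤ) : 𝓞 (realField R)) ∈ v.asIdeal := by push_cast; exact hℓv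
  have h2rpv : ((2 * r + p : ℤ) : 𝓞 (realField R)) ∉ v.asIdeal :=
    intCast_notMem_of_isCoprime v ((Prime.coprime_iff_not_dvd hℓZ).2 h2rp) hℓv'
  have hx'v : x' ∉ v.asIdeal := fun h ↦ h2rpv (by
    have e : ((2 * r + p : ℤ) : 𝓞 (realField R)) = -x - x' := by rw [hx, hx']; push_cast; ring
    rw [e]; exact v.asIdeal.sub_mem (v.asIdeal.neg_mem hxv) h)
  have hm₁v : (m₁ : 𝓞 (realField R)) ∉ v.asIdeal :=
    intCast_notMem_of_isCoprime v ((Prime.coprime_iff_not_dvd hℓZ).2 hm₁ℓ) hℓv'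
  have hordℓ := intValuation_natCast_eq_exp_neg_one_of_place v hv hxx' hx'v hm₁v
  have h2 : (2 : 𝓞 (realField R)) ∉ v.asIdeal := by
    have h2' : ¬ (ℓ : ℤ) ∣ 2 := fun h ↦ by
      have := Int.le_of_dvd (by norm_num) h; have := hℓ.two_le; omega
    have := intCast_notMem_of_isCoprime v ((Prime.coprime_iff_not_dvd hℓZ).2 h2') hℓv'
    push_cast at this; exact this
  have hθv : θₒ ∉ v.asIdeal := fun h ↦
    intCast_notMem_of_isCoprime v ((Prime.coprime_iff_not_dvd hℓZ).2 hℓq) hℓv' (intCast_mem_of_root_mem hR hθ v h)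
  have hmk : Ideal.Quotient.mk v.asIdeal θₒ = Ideal.Quotient.mk v.asIdeal (r : 𝓞 (realField R)) := by
    rw [Ideal.Quotient.eq]; exact hxv
  have hns : ¬ IsSquare (Ideal.Quotient.mk v.asIdeal θₒ) := by
    rw [hmk]
    exact fun hsq ↦ hns₀ (hrr₁ ▸ (isSquare_intCast_residue_iff_of_absNorm_eq v hℓ hNv r).1 hsq)
  -- `ord_v(ℓw) = 1`
  obtain ⟨-, hw0⟩ := log_valuation_intCast_eq_zero_of_not_dvd v hℓ hℓv hw
  have hord : WithZero.log (v.valuation (realField R) (ℓ : realField R)) = -1 := by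
    rw [show (ℓ : realField R) = algebraMap (𝓞 (realField R)) (realField R) (ℓ : 𝓞 (realField R)) by
      rw [map_natCast], HeightOneSpectrum.valuation_of_algebraMap, hordℓ, WithZero.log_exp]
  have hℓne : v.valuation (realField R) (ℓ : realField R) ≠ 0 :=
    (Valuation.ne_zero_iff _).2 (by exact_mod_cast hℓ.ne_zero)
  have hwz : w ≠ 0 := fun h ↦ hw (by rw [h]; exact dvd_zero _)
  have hwne : v.valuation (realField R) (w : realField R) ≠ 0 :=
    (Valuation.ne_zero_iff _).2 (by exact_mod_cast hwz)
  have hodd : Odd (WithZero.log (v.valuation (realField R) (qℓ : realField R))) := by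
    rw [hqℓ, map_mul, WithZero.log_mul hℓne hwne, hord, hw0]; decide
  exact mk_ne_splitDiscriminantClassCM_of_odd_log_valuation hθ v h2 hθv hns hodd k

/-- **(b′) character form with a cofactor**: if every root `r̄ ∈ 𝔽_ℓ` of `S² + pS + q` has «`r̄` square ⟺ `P`», `¬P`
holds and `p² - 4q` is a square mod `ℓ` (so a root exists), then `[ℓ·w] ≠ [(-1)^k]` for every `w` prime to `ℓ`.
[cite: Deligne1982HodgeCycles, §4 (1) and Cor. 4.2] [cite: Omeara1963, §63B Example 63:12] -/
theorem mk_natCast_mul_ne_splitDiscriminantClassCM_of_root_character {p q : ℤ} (hR : R = X ^ 2 + C p * X + C q)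
    {ℓ : ℕ} (hℓ : ℓ.Prime) (hℓ2 : ℓ ≠ 2) (hℓq : ¬ (ℓ : ℤ) ∣ q) (hdisc : ¬ (ℓ : ℤ) ∣ p ^ 2 - 4 * q)
    (hdsq : IsSquare ((p ^ 2 - 4 * q : ℤ) : ZMod ℓ)) {P : Prop}
    (hchar : ∀ r : ZMod ℓ, r ^ 2 + (p : ZMod ℓ) * r + (q : ZMod ℓ) = 0 → (IsSquare r ↔ P)) (hP : ¬ P)
    {w : ℤ} (hw : ¬ (ℓ : ℤ) ∣ w) (qℓ : (realField R)ˣ) (hqℓ : (qℓ : realField R) = (ℓ : realField R) * (w : realField R))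
    (k : ℕ) : (QuotientGroup.mk qℓ : cmNormResidueGroup R) ≠ splitDiscriminantClassCM R k := by
  haveI := Fact.mk hℓ
  have h2 : (2 : ZMod ℓ) ≠ 0 := by exact_mod_cast natCast_prime_ne_zero_zmod Nat.prime_two hℓ2
  obtain ⟨s, hs⟩ := hdsq
  push_cast at hs
  have hr₀ : ((s - p) / 2) ^ 2 + (p : ZMod ℓ) * ((s - p) / 2) + (q : ZMod ℓ) = 0 := by
    field_simp; linear_combination -hs
  exact mk_natCast_mul_ne_splitDiscriminantClassCM_of_root_not_isSquare hR hℓ hℓ2 hℓq hdisc hr₀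
    (fun hsq ↦ hP ((hchar _ hr₀).1 hsq)) hw qℓ hqℓ k

/-- **(c) A prime INERT in `F` and RAMIFIED in `E`, with a cofactor.** Let `v` be a non-dyadic place, `π ∈ 𝓞_F` a
uniformiser at `v` with `θ = π·t`, `t ∉ v`, and `-t` a NON-square mod `v`; let `w ∈ 𝓞_F ∖ v` be a square mod `v`.
Then `(π·w, θ)_v = (π·w, π·t)_v = -1` (O'Meara 63:12: `(πa, πb)_v = 1 ⟺ -ab` is a square mod `v`), so
**`[π·w] ≠ [(-1)^k]`** (`k` even). [cite: Omeara1963, §63 Example 63:12] [cite: Deligne1982HodgeCycles, §4 (1) and Cor. 4.2] -/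
theorem mk_ne_splitDiscriminantClassCM_of_uniformizer_mul {θₒ t π w : 𝓞 (realField R)}
    (hθ : (θₒ : realField R) = AdjoinRoot.root (realPolyQ R)) (v : HeightOneSpectrum (𝓞 (realField R)))
    (h2 : (2 : 𝓞 (realField R)) ∉ v.asIdeal) (hπ : v.intValuation π = WithZero.exp (-1 : ℤ)) (hθt : θₒ = π * t)
    (ht : t ∉ v.asIdeal) (hns : ¬ IsSquare (Ideal.Quotient.mk v.asIdeal (-t)))
    (hwv : w ∉ v.asIdeal) (hwsq : IsSquare (Ideal.Quotient.mk v.asIdeal w))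
    (qℓ : (realField R)ˣ) (hqℓ : (qℓ : realField R) = ((π * w : 𝓞 (realField R)) : realField R)) {k : ℕ} (hk : Even k) :
    (QuotientGroup.mk qℓ : cmNormResidueGroup R) ≠ splitDiscriminantClassCM R k := by
  haveI : v.asIdeal.IsMaximal := v.isMaximal
  -- `-(w t)` is a non-square mod `v` (`w` is a non-zero square in the residue field)
  have hnsq : ¬ IsSquare (Ideal.Quotient.mk v.asIdeal (-(w * t))) := by
    letI : Field (𝓞 (realField R) ⧸ v.asIdeal) := Ideal.Quotient.field v.asIdeal
    intro h
    have hw0 : Ideal.Quotient.mk v.asIdeal w ≠ 0 := fun h0 ↦ hwv ((Ideal.Quotient.eq_zero_iff_mem).1 h0)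
    apply hns
    have e : Ideal.Quotient.mk v.asIdeal (-t) =
        Ideal.Quotient.mk v.asIdeal (-(w * t)) * (Ideal.Quotient.mk v.asIdeal w)⁻¹ := by
      rw [map_neg, map_neg, map_mul, neg_mul, mul_comm ((Ideal.Quotient.mk v.asIdeal) w) ((Ideal.Quotient.mk v.asIdeal) t),
        mul_inv_cancel_right₀ hw0]
    rw [e]
    exact h.mul hwsq.inv
  have key := hilbertSymbol_uniformizer_mul_uniformizer_mul_iff (realField R) v h2 hπ hwv ht
  have hsym : hilbertSymbol (v.adicCompletion (realField R))
      (algebraMap (𝓞 (realField R)) _ (π * w)) (algebraMap (𝓞 (realField R)) _ (π * t)) = -1 :=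
    (hilbertSymbol_eq_one_or_eq_neg_one _ _).resolve_left fun h ↦ hnsq (key.1 h)
  have hmem : Sum.inl v ∈ badPlaces (qℓ : realField R) (AdjoinRoot.root (realPolyQ R)) := by
    rw [mem_badPlaces_iff, placeSymbol_inl, hqℓ, ← hθ, hθt,
      ← IsScalarTower.algebraMap_apply (𝓞 (realField R)) (realField R) (v.adicCompletion (realField R)),
      show ((π * t : 𝓞 (realField R)) : realField R) = algebraMap (𝓞 (realField R)) (realField R) (π * t) from rfl,
      ← IsScalarTower.algebraMap_apply (𝓞 (realField R)) (realField R) (v.adicCompletion (realField R))]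
    exact hsym
  rw [Ne, mk_eq_splitDiscriminantClassCM_iff_badPlaces_eq_empty qℓ hk, Set.eq_empty_iff_forall_notMem]
  exact fun h ↦ h _ hmem

end Summit.HodgeConjecture.HodgeConjecture.Ring2.WeilCoverageCM

end
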